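import Mathlib
import Summits.ValiantsHypothesis.ValiantsHypothesis.Theorems.FeketeSOSCharPSparseSOSStubDictionaryAtInfinity
import Summits.ValiantsHypothesis.ValiantsHypothesis.Theorems.FeketeSOSCharPSparseSOSStubFeketeCuspZero
import Summits.ValiantsHypothesis.ValiantsHypothesis.Theorems.FeketeSOSCharPSparseSOSTwoCuspTrivial
import Summits.ValiantsHypothesis.ValiantsHypothesis.Theorems.CharPSparseSOS.Negative.LoadBearing

/-!
# Crux `FeketeSOS.CharPSparseSOS` (stmt-ValiantsHypothesis-14989), line `Sketch` — the signed quartic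
barrier: the THREE-square case of the two-cusp inequality is a `p^δ`-robust index-4 Sárközy theorem

Let `p = 4N + 1` be prime.  The quartic target `Tq = ∑_{n<p} (n^N + n^{3N}) X^n = 2 ∑ ψ̃(n) X^n` (`ψ̃` = the
quartic sign on the non-zero squares, `0` elsewhere; interpolation polynomial `½(U^N + U^{3N})`) is deep
EXACTLY `N = (p−1)/4` at both cusps of the line's dictionary (`sqb_target_deep`: power sums in characteristic
`p`).  For ANY `Q ⊆ [0,p)` and ANY weights `w`, the weighted fold identity
`(∑_{a∈Q} w_a X^a)² ≡ ∑_{n<p} u(n) X^n (mod X^p − 1)` (`u` = cyclic autocorrelation of `(Q,w)`) and the error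
polynomial `B = ∑_{n<p} (u(n) − (n^N + n^{3N})) X^n` (at most `e = #{n < p : u(n) ≠ 2ψ̃(n)}` monomials) give
the three-square cyclic representation `Tq ≡ Cw² − ¼(1+B)² + ¼(1−B)²` of degree `< p` and support-sum
`≤ |Q| + 2e + 2` (`sqb_witness`).  Hence the registered first open case `twoCuspInequality_s_three` of the
load-bearing stub (three squares, two cusps, any power saving `θ < 2`) forces, for all large `p ≡ 1 (mod 4)`
and all `(Q, w)`: `p^{1/2+δ} ≤ |Q| + 2·#{n < p : u(n) ≠ 2ψ̃(n)} + 2`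
(`signedQuarticFar_of_twoCuspInequality_s_three`).  Reading: signed near-perfect restricted-sum bases of the
quartic pattern (`|Q| ≈ √p`, `e ≈ |Q|`) must carry `≥ p^{1/2+δ}/2 − O(√p)` errors — a POWER-robust form of the
non-decomposition theorems for the index-2/4 subgroups of `𝔽_p^×` (exact forms: Shkredov 2014, Yip 2023,
Kalmynin 2025, Rudnev–Tyrrell 2026) in the range where the completion bound `√(|A||B|p)` is tight.
-/

-- `Summit.ValiantsHypothesis.ValiantsHypothesis.…` is the tree's mandated single-conjunct layout (Sub = Summit).
set_option linter.dupNamespace false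

namespace Summit.ValiantsHypothesis.ValiantsHypothesis.Theorems.CharPSparseSOSTwoCusp

open Polynomial Finset
open Summit.ValiantsHypothesis.ValiantsHypothesis.Theorems.CharPSparseSOS.Negative
  (card_support_add_le card_support_sub_le four_ne_zero_zmod)

noncomputable section

section Target

variable {K : Type} [Field K] (p : ℕ)

/-- Coefficients of a polynomial given on `range p`: `(∑_{m<p} C(f m) X^m).coeff n = f n` for `n < p`. -/
theorem sqb_coeff_sum_lt (f : ℕ → K) (n : ℕ) (hn : n < p) :
    (∑ m ∈ range p, C (f m) * X ^ m).coeff n = f n := by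
  simp only [finsetSum_coeff, coeff_C_mul_X_pow, sum_ite_eq, mem_range, if_pos hn]

/-- `deg (∑_{m<p} C(f m) X^m) < p` (as `natDegree`, for `0 < p`). -/
theorem sqb_natDegree_sum_lt (f : ℕ → K) (hp : 0 < p) :
    (∑ m ∈ range p, C (f m) * X ^ m).natDegree < p := by
  have h : (∑ m ∈ range p, C (f m) * X ^ m).natDegree ≤ p - 1 :=
    natDegree_sum_le_of_forall_le _ _ fun m hm => (natDegree_C_mul_X_pow_le _ _).trans (by
      have := mem_range.1 hm; omega)
  omega

/-- A moment of `∑_{m<p} C(f m) X^m` is the weighted power sum `∑_{n<p} f(n) n^e`. -/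
theorem sqb_moment_eq (f : ℕ → K) (e : ℕ) :
    ∑ n ∈ range p, (∑ m ∈ range p, C (f m) * X ^ m).coeff n * (n : K) ^ e =
      ∑ n ∈ range p, f n * (n : K) ^ e :=
  sum_congr rfl fun n hn => by rw [sqb_coeff_sum_lt p f n (mem_range.1 hn)]

variable [Fact p.Prime] [CharP K p]

/-- Fermat shift of power sums: `∑_{n<p} n^{j+(p−1)} = ∑_{n<p} n^j` in characteristic `p` for `1 ≤ j`
(termwise: `0^· = 0`, and `n^{p−1} = 1` for `0 < n < p`). -/
theorem sqb_sum_pow_add_sub_one (j : ℕ) (hj : 1 ≤ j) :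
    ∑ n ∈ range p, (n : K) ^ (j + (p - 1)) = ∑ n ∈ range p, (n : K) ^ j := by
  refine sum_congr rfl fun n hn => ?_
  rcases Nat.eq_zero_or_pos n with rfl | hn0
  · rw [Nat.cast_zero, zero_pow (by omega), zero_pow (by omega)]
  · rw [pow_add, fcz_natCast_pow_sub_one p n hn0 (mem_range.1 hn), mul_one]

/-- Vanishing of the shifted power sums `∑_{n<p} n^{j+(p−1)} = 0` for `1 ≤ j < p − 1`. -/
theorem sqb_sum_pow_add_sub_one_eq_zero (j : ℕ) (hj : 1 ≤ j) (hjp : j < p - 1) :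
    ∑ n ∈ range p, (n : K) ^ (j + (p - 1)) = 0 := by
  rw [sqb_sum_pow_add_sub_one p j hj, fcz_sum_pow_eq_zero p j hjp]

/-- **Upper-cusp moments of the quartic target.**  With `p = 4N + 1`, the weighted power sums
`∑_{n<p} (n^N + n^{3N}) n^a` vanish for `a < N` (exponents `N + a, 3N + a ∈ [1, p−2]`). -/
theorem sqb_target_upper_moment (N : ℕ) (hpN : p = 4 * N + 1) (hN : 1 ≤ N) (a : ℕ) (ha : a < N) :
    ∑ n ∈ range p, ((n : K) ^ N + (n : K) ^ (3 * N)) * (n : K) ^ a = 0 := by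
  simp only [add_mul, ← pow_add, sum_add_distrib]
  rw [fcz_sum_pow_eq_zero p (N + a) (by omega), fcz_sum_pow_eq_zero p (3 * N + a) (by omega), add_zero]

/-- **Lower-cusp moments of the quartic target.**  With `p = 4N + 1`, the top moments
`∑_{n<p} (n^N + n^{3N}) n^{p−1−d}` vanish for `1 ≤ d < N` (Fermat shift to the exponents `N − d, 3N − d`). -/
theorem sqb_target_lower_moment (N : ℕ) (hpN : p = 4 * N + 1) (d : ℕ) (hd1 : 1 ≤ d) (hdN : d < N) :
    ∑ n ∈ range p, ((n : K) ^ N + (n : K) ^ (3 * N)) * (n : K) ^ (p - 1 - d) = 0 := by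
  simp only [add_mul, ← pow_add, sum_add_distrib]
  have h1 : N + (p - 1 - d) = (N - d) + (p - 1) := by omega
  have h3 : 3 * N + (p - 1 - d) = (3 * N - d) + (p - 1) := by omega
  rw [h1, h3, sqb_sum_pow_add_sub_one_eq_zero p (N - d) (by omega) (by omega),
    sqb_sum_pow_add_sub_one_eq_zero p (3 * N - d) (by omega) (by omega), add_zero]

/-- **The quartic target is two-cusp deep `N`.**  For `p = 4N + 1` prime and
`Tq = ∑_{n<p} (n^N + n^{3N}) X^n` over a field of characteristic `p`: `Tq ≠ 0`, `deg Tq < p`,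
`(X − 1)^N ∣ Tq` (dictionary at infinity), `Tq₀ = 0`, and the top moments vanish for `1 ≤ d < N`. -/
theorem sqb_target_deep (N : ℕ) (hpN : p = 4 * N + 1) (hN : 1 ≤ N) :
    (∑ m ∈ range p, C ((m : K) ^ N + (m : K) ^ (3 * N)) * X ^ m) ≠ 0 ∧
    (∑ m ∈ range p, C ((m : K) ^ N + (m : K) ^ (3 * N)) * X ^ m).natDegree < p ∧
    (X - C (1 : K)) ^ N ∣ (∑ m ∈ range p, C ((m : K) ^ N + (m : K) ^ (3 * N)) * X ^ m) ∧
    (∑ m ∈ range p, C ((m : K) ^ N + (m : K) ^ (3 * N)) * X ^ m).coeff 0 = 0 ∧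
    (∀ d : ℕ, 1 ≤ d → d < N → ∑ n ∈ range p,
      (∑ m ∈ range p, C ((m : K) ^ N + (m : K) ^ (3 * N)) * X ^ m).coeff n * (n : K) ^ (p - 1 - d) = 0) := by
  have hp2 : p ≠ 2 := by omega
  have hp0 : 0 < p := by omega
  set f : ℕ → K := fun m => (m : K) ^ N + (m : K) ^ (3 * N) with hf
  have hdeg := sqb_natDegree_sum_lt p f hp0
  refine ⟨?_, hdeg, ?_, ?_, ?_⟩
  · -- coefficient at `X¹` is `2 ≠ 0`
    intro h0
    have h1 : (∑ m ∈ range p, C (f m) * X ^ m).coeff 1 = 2 := by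
      rw [sqb_coeff_sum_lt p f 1 (by omega), hf]
      simp only [Nat.cast_one, one_pow]; norm_num
    rw [h0, coeff_zero] at h1
    exact Ring.two_ne_zero (R := K) (by rw [ringChar.eq K p]; exact hp2) h1.symm
  · -- upper cusp via the dictionary at infinity
    refine (stub_dictionaryAtInfinity K p _ N hdeg (by omega)).2 fun a ha => ?_
    rw [sqb_moment_eq p f a, hf]
    exact sqb_target_upper_moment p N hpN hN a ha
  · rw [sqb_coeff_sum_lt p f 0 hp0, hf]
    simp only [Nat.cast_zero, zero_pow (show N ≠ 0 by omega), zero_pow (show 3 * N ≠ 0 by omega),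
      add_zero]
  · intro d hd1 hdN
    rw [sqb_moment_eq p f (p - 1 - d), hf]
    exact sqb_target_lower_moment p N hpN d hd1 hdN

end Target

/-- **Closed form of the quartic sign.**  For a prime `p ≡ 1 (mod 4)` and every `n`, twice the quartic sign
`ψ̃(n) ∈ {1, −1, 0}` (decided by `(n : 𝔽_p)^{(p−1)/4} = 1, −1`, or neither) equals `n^{N} + n^{3N}` in `𝔽_p`
(`N = p / 4 = (p−1)/4`): if `n ≡ 0` both sides vanish; otherwise `y = n^N` has `y⁴ = 1`, and `y + y³` is `2`,
`−2` or `y(1 + y²) = 0` according as `y = 1`, `y = −1`, or `y² = −1`. -/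
theorem sqb_two_mul_quarticSign (p : ℕ) [Fact p.Prime] (hp4 : p % 4 = 1) (n : ℕ) :
    ((2 * (if (n : ZMod p) ^ (p / 4) = 1 then (1 : ℤ)
        else if (n : ZMod p) ^ (p / 4) = -1 then -1 else 0) : ℤ) : ZMod p) =
      (n : ZMod p) ^ (p / 4) + (n : ZMod p) ^ (3 * (p / 4)) := by
  have hprime : p.Prime := Fact.out
  have hp5 : 5 ≤ p := by
    have h2 := hprime.two_le
    by_contra h
    interval_cases p <;> simp_all (config := {decide := true})
  set N := p / 4 with hN
  set y : ZMod p := (n : ZMod p) ^ N with hy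
  have hy3 : (n : ZMod p) ^ (3 * N) = y ^ 3 := by rw [hy, ← pow_mul, mul_comm]
  rw [hy3]
  by_cases hn0 : (n : ZMod p) = 0
  · rw [show y = 0 by rw [hy, hn0, zero_pow (by omega)], if_neg zero_ne_one,
      if_neg (fun h => one_ne_zero (neg_eq_zero.1 h.symm))]
    push_cast; ring
  · have hy4 : y ^ 4 = 1 := by
      rw [hy, ← pow_mul, show N * 4 = p - 1 by omega]
      exact ZMod.pow_card_sub_one_eq_one hn0
    by_cases h1 : y = 1
    · rw [if_pos h1, h1]; push_cast; ring
    · rw [if_neg h1]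
      by_cases h2 : y = -1
      · rw [if_pos h2, h2]; push_cast; ring
      · rw [if_neg h2]
        have hfac : (y - 1) * (y + 1) * (y ^ 2 + 1) = 0 := by
          have : (y - 1) * (y + 1) * (y ^ 2 + 1) = y ^ 4 - 1 := by ring
          rw [this, hy4, sub_self]
        have hy2 : y ^ 2 + 1 = 0 := by
          rcases mul_eq_zero.1 hfac with h12 | h3
          · rcases mul_eq_zero.1 h12 with h4 | h5
            · exact absurd (sub_eq_zero.1 h4) h1
            · exact absurd (eq_neg_of_add_eq_zero_left h5) h2
          · exact h3
        rw [show y + y ^ 3 = y * (y ^ 2 + 1) by ring, hy2, mul_zero]; push_cast; ring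

section Witness

variable {K : Type} [Field K]

/-- The support of `∑_{n∈s} C(w n) X^n` lies in `{n ∈ s : w(n) ≠ 0}`. -/
theorem sqb_support_sum_C_mul_X_pow_subset [DecidableEq K] (s : Finset ℕ) (w : ℕ → K) :
    (∑ n ∈ s, C (w n) * X ^ n).support ⊆ s.filter (fun n => w n ≠ 0) := by
  intro k hk
  rw [mem_support_iff, finsetSum_coeff] at hk
  simp only [coeff_C_mul_X_pow, sum_ite_eq] at hk
  rw [mem_filter]
  by_cases hks : k ∈ s
  · rw [if_pos hks] at hk; exact ⟨hks, hk⟩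
  · rw [if_neg hks] at hk; exact absurd rfl hk

/-- **Weighted fold identity** (no hypothesis on `Q`, `w`): modulo `X^p − 1`,
`(∑_{a∈Q} w_a X^a)² ≡ ∑_{n<p} u(n) X^n` with the cyclic autocorrelation
`u(n) = ∑_{(a,b) ∈ Q×Q, a+b ≡ n} w_a w_b`. -/
theorem sqb_weighted_fold (p : ℕ) (hp : 0 < p) (Q : Finset ℕ) (w : ℕ → K) :
    (X : K[X]) ^ p - 1 ∣ (∑ a ∈ Q, C (w a) * X ^ a) ^ 2 -
      ∑ n ∈ range p, C (∑ ab ∈ (Q ×ˢ Q).filter (fun ab : ℕ × ℕ => (ab.1 + ab.2) % p = n),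
        w ab.1 * w ab.2) * X ^ n := by
  classical
  have hsq : (∑ a ∈ Q, C (w a) * X ^ a) ^ 2 =
      ∑ ab ∈ Q ×ˢ Q, C (w ab.1 * w ab.2) * X ^ (ab.1 + ab.2) := by
    rw [sq, sum_mul_sum, sum_product]
    refine sum_congr rfl fun a _ => sum_congr rfl fun b _ => ?_
    rw [map_mul, pow_add]; ring
  have hfib : ∑ ab ∈ Q ×ˢ Q, C (w ab.1 * w ab.2) * X ^ ((ab.1 + ab.2) % p) =
      ∑ n ∈ range p, C (∑ ab ∈ (Q ×ˢ Q).filter (fun ab : ℕ × ℕ => (ab.1 + ab.2) % p = n),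
        w ab.1 * w ab.2) * X ^ n := by
    rw [← sum_fiberwise_of_maps_to (s := Q ×ˢ Q) (t := range p)
      (g := fun ab : ℕ × ℕ => (ab.1 + ab.2) % p) (fun ab _ => mem_range.2 (Nat.mod_lt _ hp))]
    refine sum_congr rfl fun n _ => ?_
    rw [map_sum, sum_mul]
    refine sum_congr rfl fun ab hab => ?_
    rw [(mem_filter.1 hab).2]
  rw [hsq, ← hfib, ← sum_sub_distrib]
  refine dvd_sum fun ab _ => ?_
  rw [← mul_sub]
  exact Dvd.dvd.mul_left (tct_X_pow_sub_one_dvd p _) _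

/-- `Cw² − ¼(1+B)² + ¼(1−B)² = Cw² − B` whenever `4 ≠ 0` in `K`. -/
theorem sqb_three_sum (h4 : (4 : K) ≠ 0) (Cw B : K[X]) :
    (∑ i, C ((![1, -1 / 4, 1 / 4] : Fin 3 → K) i) * (![Cw, 1 + B, 1 - B] : Fin 3 → K[X]) i ^ 2) =
      Cw ^ 2 - B := by
  have h4' : C (1 / 4 : K) * 4 = 1 := by
    rw [show (4 : K[X]) = C 4 from (map_ofNat C 4).symm, ← C_mul, ← C_1]
    congr 1; exact one_div_mul_cancel h4
  have hneg : C (-1 / 4 : K) = -C (1 / 4 : K) := by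
    rw [← map_neg]; congr 1; ring
  simp only [Fin.sum_univ_succ, Fin.sum_univ_zero, Matrix.cons_val_zero, Matrix.cons_val_succ, hneg,
    C_1, one_mul, add_zero]
  linear_combination (-B) * h4'

/-- **The three-square witness.**  Let `p` be prime with `4 ≠ 0` in `K` (char `K = p`), `Q ⊆ [0,p)`,
`w : ℕ → K` weights, `u` the cyclic autocorrelation of `(Q, w)` and `f : ℕ → K` ANY target coefficient
function; let `e ≥ #{n < p : u(n) ≠ f(n)}`.  Then the weights `1, −¼, ¼` and the bases `Cw = ∑_{a∈Q} w_a X^a`,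
`1 ± B` (`B = ∑_{n<p} (u(n) − f(n)) X^n`, the error polynomial) form a cyclic representation of
`∑_{n<p} f(n) X^n` of degree `< p` with support-sum `≤ |Q| + 2e + 2`. -/
theorem sqb_witness [DecidableEq K] (p : ℕ) [Fact p.Prime] (h4 : (4 : K) ≠ 0) (Q : Finset ℕ) (hQ : ∀ a ∈ Q, a < p)
    (w : ℕ → K) (f : ℕ → K) (e : ℕ)
    (he : ((range p).filter (fun n => (∑ ab ∈ (Q ×ˢ Q).filter
      (fun ab : ℕ × ℕ => (ab.1 + ab.2) % p = n), w ab.1 * w ab.2) ≠ f n)).card ≤ e) :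
    ∃ (c : Fin 3 → K) (g : Fin 3 → K[X]), (∀ i, (g i).natDegree < p) ∧
      ((X : K[X]) ^ p - 1 ∣ (∑ i, C (c i) * g i ^ 2) - ∑ n ∈ range p, C (f n) * X ^ n) ∧
      (∑ i, (g i).support.card) ≤ Q.card + 2 * e + 2 := by
  classical
  have hprime : p.Prime := Fact.out
  have hp0 : 0 < p := hprime.pos
  set u : ℕ → K := fun n => ∑ ab ∈ (Q ×ˢ Q).filter (fun ab : ℕ × ℕ => (ab.1 + ab.2) % p = n),
    w ab.1 * w ab.2 with hu
  set Cw : K[X] := ∑ a ∈ Q, C (w a) * X ^ a with hCw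
  set B : K[X] := ∑ n ∈ range p, C (u n - f n) * X ^ n with hB
  refine ⟨![1, -1 / 4, 1 / 4], ![Cw, 1 + B, 1 - B], ?_, ?_, ?_⟩
  · -- degrees
    have hC : Cw.natDegree ≤ p - 1 :=
      natDegree_sum_le_of_forall_le _ _ fun a ha => (natDegree_C_mul_X_pow_le _ _).trans (by
        have := hQ a ha; omega)
    have hBd : B.natDegree < p := sqb_natDegree_sum_lt p _ hp0
    have h1 : (1 : K[X]).natDegree < p := by rw [natDegree_one]; exact hp0
    intro i
    fin_cases i
    · exact lt_of_le_of_lt hC (by omega)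
    · exact lt_of_le_of_lt (natDegree_add_le _ _) (max_lt h1 hBd)
    · exact lt_of_le_of_lt (natDegree_sub_le _ _) (max_lt h1 hBd)
  · -- the cyclic identity: Cw² − B − F = (Cw² − U) + (U − B − F), and U − B = F exactly
    rw [sqb_three_sum h4]
    have hUB : (∑ n ∈ range p, C (u n) * X ^ n) - B = ∑ n ∈ range p, C (f n) * X ^ n := by
      rw [hB, ← sum_sub_distrib]
      refine sum_congr rfl fun n _ => ?_
      rw [← sub_mul, ← map_sub, sub_sub_cancel]
    rw [show Cw ^ 2 - B - ∑ n ∈ range p, C (f n) * X ^ n = Cw ^ 2 - ∑ n ∈ range p, C (u n) * X ^ n by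
      rw [← hUB]; ring]
    exact sqb_weighted_fold p hp0 Q w
  · -- support-sum bookkeeping
    have hC : Cw.support.card ≤ Q.card :=
      (card_le_card (sqb_support_sum_C_mul_X_pow_subset Q w)).trans (card_filter_le _ _)
    have hBc : B.support.card ≤ e := by
      refine (card_le_card (sqb_support_sum_C_mul_X_pow_subset (range p) _)).trans
        (le_trans (card_le_card ?_) he)
      intro n hn
      rw [mem_filter] at hn ⊢
      exact ⟨hn.1, fun h => hn.2 (show (∑ ab ∈ (Q ×ˢ Q).filter (fun ab : ℕ × ℕ =>
        (ab.1 + ab.2) % p = n), w ab.1 * w ab.2) - f n = 0 by rw [h, sub_self])⟩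
    have h1 : (1 : K[X]).support.card ≤ 1 := by
      have := card_support_C_mul_X_pow_le_one (c := (1 : K)) (n := 0)
      rwa [C_1, one_mul, pow_zero] at this
    have e1 := (card_support_add_le (1 : K[X]) B).trans (Nat.add_le_add h1 hBc)
    have e2 := (card_support_sub_le (1 : K[X]) B).trans (Nat.add_le_add h1 hBc)
    simp only [Fin.sum_univ_succ, Fin.sum_univ_zero, Matrix.cons_val_zero, Matrix.cons_val_succ]
    omega

end Witness

/-- **The three-square two-cusp inequality is a `p^δ`-robust index-4 Sárközy theorem.**
The registered first open case `twoCuspInequality_s_three` of the line's load-bearing stub (three weighted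
squares of degree `< p`, non-zero fold deep `≥ D` at both cusps ⇒ `D ≤ C₀ (Σ #supp gᵢ)^θ` with `θ < 2`)
implies: there is `δ > 0` such that for all large primes `p ≡ 1 (mod 4)`, every `Q ⊆ [0, p)` and every
integer weight `w`,
`p^{1/2+δ} ≤ |Q| + 2·#{n < p : u(n) ≠ 2ψ̃(n)} + 2`,
where `u(n) = ∑_{(a,b)∈Q×Q, a+b≡n} w_a w_b` is the cyclic autocorrelation and `ψ̃` the quartic sign
(`+1`/`−1` according as `(n : 𝔽_p)^{(p−1)/4} = ±1`, else `0`).  Proof: the three-square witness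
`sqb_witness` over `ZMod p` folds to the quartic target `Tq = ∑ (n^N + n^{3N}) X^n`, which is deep
`N = (p−1)/4` at both cusps (`sqb_target_deep`), with support-sum `≤ |Q| + 2e + 2`; so
`(p−1)/4 ≤ C₀ (|Q| + 2e + 2)^θ`, and `|Q| + 2e + 2 < p^{1/2+δ}` with `δ = (2−θ)/8` would give
`p ≤ 8 C₀ p^{θ(1/2+δ)} + … < p` for large `p`. -/
theorem signedQuarticFar_of_twoCuspInequality_s_three :
    (∃ (C₀ θ : ℝ), 0 < C₀ ∧ 0 ≤ θ ∧ θ < 2 ∧ ∀ (K : Type) [Field K] (p : ℕ) [Fact p.Prime] [CharP K p]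
      (c : Fin 3 → K) (g : Fin 3 → K[X]) (P : K[X]) (D : ℕ), (∀ i, (g i).natDegree < p) →
      P = (∑ i, C (c i) * g i ^ 2) %ₘ (X ^ p - 1) → P ≠ 0 → (X - C (1 : K)) ^ D ∣ P →
      (1 ≤ D → P.coeff 0 = 0) →
      (∀ d : ℕ, 1 ≤ d → d < D → ∑ n ∈ Finset.range p, P.coeff n * (n : K) ^ (p - 1 - d) = 0) →
      (D : ℝ) ≤ C₀ * ((∑ i, (g i).support.card : ℕ) : ℝ) ^ θ) →
    ∃ δ : ℝ, 0 < δ ∧ ∃ p₁ : ℕ, ∀ (p : ℕ) [Fact p.Prime], p₁ ≤ p → p % 4 = 1 →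
      ∀ (Q : Finset ℕ) (w : ℕ → ℤ), (∀ a ∈ Q, a < p) →
        (p : ℝ) ^ (1 / 2 + δ) ≤ (Q.card : ℝ) +
          2 * (((Finset.range p).filter (fun n =>
            (∑ ab ∈ (Q ×ˢ Q).filter (fun ab : ℕ × ℕ => (ab.1 + ab.2) % p = n), w ab.1 * w ab.2) ≠
              2 * (if (n : ZMod p) ^ (p / 4) = 1 then (1 : ℤ)
                else if (n : ZMod p) ^ (p / 4) = -1 then -1 else 0))).card : ℝ) + 2 := by
  rintro ⟨C₀, θ, hC₀, hθ0, hθ2, h⟩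
  -- exponents: δ = (2−θ)/8, ε = θ(1/2+δ), η = 1 − ε > 0
  set δ : ℝ := (2 - θ) / 8 with hδ
  have hδpos : 0 < δ := by rw [hδ]; linarith
  set ε : ℝ := θ * (1 / 2 + δ) with hε
  set η : ℝ := 1 - ε with hη
  have hηpos : 0 < η := by rw [hη, hε, hδ]; nlinarith
  have hε0 : 0 ≤ ε := by rw [hε]; positivity
  -- threshold
  set L : ℝ := 8 * (C₀ + 1) with hL
  have hL0 : 0 < L := by rw [hL]; positivity
  refine ⟨δ, hδpos, max (⌈L ^ (1 / η)⌉₊) 5, ?_⟩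
  intro p _ hp hp4 Q w hQ
  have hprime : p.Prime := Fact.out
  have hp5 : 5 ≤ p := le_of_max_le_right hp
  have hpceil : ⌈L ^ (1 / η)⌉₊ ≤ p := le_of_max_le_left hp
  have h4 : (4 : ZMod p) ≠ 0 := four_ne_zero_zmod p hp5
  set N := p / 4 with hN
  have hpN : p = 4 * N + 1 := by omega
  have hN1 : 1 ≤ N := by omega
  -- name the error count `e` of the statement
  obtain ⟨e, he_def⟩ : ∃ e : ℕ, e = ((Finset.range p).filter (fun n =>
      (∑ ab ∈ (Q ×ˢ Q).filter (fun ab : ℕ × ℕ => (ab.1 + ab.2) % p = n), w ab.1 * w ab.2) ≠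
        2 * (if (n : ZMod p) ^ N = 1 then (1 : ℤ)
          else if (n : ZMod p) ^ N = -1 then -1 else 0))).card := ⟨_, rfl⟩
  rw [← he_def]
  -- the error count over `ZMod p` (against the closed form `n^N + n^{3N}`) is at most `e`
  have he : ((range p).filter (fun n => (∑ ab ∈ (Q ×ˢ Q).filter
      (fun ab : ℕ × ℕ => (ab.1 + ab.2) % p = n), ((w ab.1 : ZMod p)) * ((w ab.2 : ZMod p))) ≠
        (n : ZMod p) ^ N + (n : ZMod p) ^ (3 * N))).card ≤ e := by
    rw [he_def]
    refine card_le_card fun n hn => ?_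
    rw [mem_filter] at hn ⊢
    refine ⟨hn.1, fun heq => hn.2 ?_⟩
    have h2 := sqb_two_mul_quarticSign p hp4 n
    rw [← hN] at h2
    calc (∑ ab ∈ (Q ×ˢ Q).filter (fun ab : ℕ × ℕ => (ab.1 + ab.2) % p = n),
          ((w ab.1 : ZMod p)) * ((w ab.2 : ZMod p)))
        = ((∑ ab ∈ (Q ×ˢ Q).filter (fun ab : ℕ × ℕ => (ab.1 + ab.2) % p = n),
            w ab.1 * w ab.2 : ℤ) : ZMod p) := by push_cast; rfl
      _ = (((2 * (if (n : ZMod p) ^ N = 1 then (1 : ℤ)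
            else if (n : ZMod p) ^ N = -1 then -1 else 0)) : ℤ) : ZMod p) := by rw [heq]
      _ = (n : ZMod p) ^ N + (n : ZMod p) ^ (3 * N) := h2
  obtain ⟨c, g, hdeg, hdvd, hsupp⟩ := sqb_witness p h4 Q hQ (fun a => (w a : ZMod p))
    (fun m => (m : ZMod p) ^ N + (m : ZMod p) ^ (3 * N)) e he
  -- the fold of the witness IS the quartic target, which is two-cusp deep `N`
  obtain ⟨hTne, hTdeg, hTdvd, hT0, hTmom⟩ := sqb_target_deep (K := ZMod p) p N hpN hN1
  have hmonic : ((X : (ZMod p)[X]) ^ p - 1).Monic := by rw [← C_1]; exact monic_X_pow_sub_C _ hprime.ne_zero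
  have hXdeg : ((X : (ZMod p)[X]) ^ p - 1).natDegree = p := by rw [← C_1, natDegree_X_pow_sub_C]
  have hfold : (∑ m ∈ range p, C ((m : ZMod p) ^ N + (m : ZMod p) ^ (3 * N)) * X ^ m) =
      (∑ i, C (c i) * g i ^ 2) %ₘ (X ^ p - 1) := by
    rw [modByMonic_eq_of_dvd_sub hmonic hdvd]
    exact ((modByMonic_eq_self_iff hmonic).mpr (degree_lt_degree (by rw [hXdeg]; exact hTdeg))).symm
  have key := h (ZMod p) p c g _ N hdeg hfold hTne hTdvd (fun _ => hT0) hTmom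
  -- reals
  have hp1 : (1 : ℝ) ≤ (p : ℝ) := by exact_mod_cast hprime.one_lt.le
  have hp0 : (0 : ℝ) < (p : ℝ) := by linarith
  have hceil : L ^ (1 / η) ≤ (p : ℝ) := le_trans (Nat.le_ceil _) (by exact_mod_cast hpceil)
  have hbig : L ≤ (p : ℝ) ^ η := by
    have h1 : (L ^ (1 / η)) ^ η ≤ (p : ℝ) ^ η :=
      Real.rpow_le_rpow (Real.rpow_nonneg hL0.le _) hceil hηpos.le
    rwa [← Real.rpow_mul hL0.le, one_div_mul_cancel hηpos.ne', Real.rpow_one] at h1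
  have hsplit : (p : ℝ) = (p : ℝ) ^ ε * (p : ℝ) ^ η := by
    rw [← Real.rpow_add hp0, hη, add_sub_cancel, Real.rpow_one]
  have hone : 1 ≤ (p : ℝ) ^ ε := Real.one_le_rpow hp1 hε0
  by_contra hlt
  push Not at hlt
  -- T ≤ |Q| + 2e + 2 < p^{1/2+δ}
  set T : ℕ := ∑ i, (g i).support.card with hT
  have hTle : (T : ℝ) ≤ (Q.card : ℝ) + 2 * (e : ℝ) + 2 := by
    have : ((T : ℕ) : ℝ) ≤ ((Q.card + 2 * e + 2 : ℕ) : ℝ) := by exact_mod_cast hsupp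
    push_cast at this; exact this
  have hTlt : (T : ℝ) < (p : ℝ) ^ (1 / 2 + δ) := lt_of_le_of_lt hTle hlt
  have hT0 : (0 : ℝ) ≤ (T : ℝ) := Nat.cast_nonneg T
  have hTθ : (T : ℝ) ^ θ ≤ (p : ℝ) ^ ε := by
    have h1 : (T : ℝ) ^ θ ≤ ((p : ℝ) ^ (1 / 2 + δ)) ^ θ := Real.rpow_le_rpow hT0 hTlt.le hθ0
    rwa [← Real.rpow_mul hp0.le, mul_comm, ← hε] at h1
  have hNle : (N : ℝ) ≤ C₀ * (p : ℝ) ^ ε := le_trans key (mul_le_mul_of_nonneg_left hTθ hC₀.le)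
  -- contradiction: p = p^ε p^η ≥ p^ε L = 8 C₀ p^ε + 8 p^ε ≥ 8 N + 8 > 4 N + 1 = p
  have hpR : (p : ℝ) = 4 * (N : ℝ) + 1 := by rw [hpN]; push_cast; ring
  have hPε0 : 0 ≤ (p : ℝ) ^ ε := le_trans zero_le_one hone
  have h1 : (p : ℝ) ^ ε * L ≤ (p : ℝ) ^ ε * (p : ℝ) ^ η := mul_le_mul_of_nonneg_left hbig hPε0
  rw [← hsplit, hL] at h1
  nlinarith

end

end Summit.ValiantsHypothesis.ValiantsHypothesis.Theorems.CharPSparseSOSTwoCusp
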